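import Literature.Probability.Percolation.TwoSetConditionalAssociation
import HarnessLib

/-!
# `NoHeavyLowerTail` (stmt-CriticalPhenomena-4575) — the PATH EXCHANGE: a new four-point correlation
# inequality from van den Berg–Häggström–Kahn's two-set conditional association

Support file (prover prim-gen-kcluster gen 2; `--supports stmt-CriticalPhenomena-4575`).  No definitions, no sorries.

For bond percolation with arbitrary edge probabilities on a finite vertex type and vertices `o, x, y, b`,
write `P(π)` for the probability that the open clusters partition `{o, x, y, b}` as `π`.  The tree has the
tripod exchange (C⁺) `P(ox|yb) · P(oy|xb) ≤ P(oxb|y) · P(oyb|x)` (`Literature.…tripodExchange`).  This file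
proves its companion with two singletons,

  **(path exchange)**   `P(ox|yb) · P(o|xb|y) ≤ P(oxb|y) · P(o|x|yb)`,

i.e. `μ({o↔x}∩{y↔b}∩{x↮y}) · μ({x↔b}∩{o↮x}∩{o↮y}∩{x↮y}) ≤ μ({o↔x}∩{x↔b}∩{x↮y}) · μ({y↔b}∩{o↮x}∩{o↮y}∩{x↮y})`
(`pathExchange`).  Proof (new): condition on `D' = {y ↮ x, y ↮ o}` and use the two-SET conditional
association of BHK 2006 (Thm. 1.5 / 2.1 with `S = {x, o}`, `T = {y}`, tree theorem `setClusterEventExchange`)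
for the increasing events `A₁ = {x ↔ o}` (reachability INSIDE the edge set `C_S`), `A₂ = {S ↔ b}` of `C_S` and
`B₁ = {y ↔ b}`, `B₂ = ⊤` of `C_T`:  `μ(D'∩A₁∩B₁) · μ(D'∩A₂) ≤ μ(D'∩A₁∩A₂) · μ(D'∩B₁)` (`pathExchange_set`),
and read the four events on the partition lattice (`μ(D'∩A₂) ≥ P(oxb|y) + P(o|xb|y)`,
`μ(D'∩B₁) = P(ox|yb) + P(o|x|yb)`).  Consumers (next files of this seat): the "diamond" inequality
`μ(o↔x | x↮b, y↔b) ≤ μ(o↔x | x↔b, y↮b)` and the ratio form of Kozma–Nitzan's Lemma 3(ii)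
`μ(o↔x | x↮b) ≤ μ(o↔x | y↮b)` for `μ(x↮b) ≥ μ(y↮b)`, which is the two-relay case of the worst-first
gluing chain (`Theorems.eventGluing_of_worstFirst`).
-/

noncomputable section

namespace Summit.CriticalPhenomena.PercolationContinuityZ3.Theorems

open MeasureTheory Set Literature.Probability.LatticeModels Literature.Probability.Percolation
open scoped Classical

namespace PathExchange

variable {V : Type*}

/-- Reachability inside an edge set is monotone in the edge set. [folklore] -/
theorem reachIn_mono (u v : V) ⦃C C' : Set (Sym2 V)⦄ (h : C ⊆ C')
    (huv : (SimpleGraph.fromEdgeSet C).Reachable u v) : (SimpleGraph.fromEdgeSet C').Reachable u v :=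
  huv.mono (SimpleGraph.fromEdgeSet_mono h)

/-- An open walk from `x` runs inside the open edge cluster of `x`: if `x ↔ u` and `p` is an open walk from
`u` to `v`, then `v` is reachable from any vertex already reachable from `x` inside `C_x`, in particular
`(fromEdgeSet C_x).Reachable x u → (fromEdgeSet C_x).Reachable x v`. [folklore] -/
theorem reachIn_cluster_of_walk (ω : BondConfig V) (x : V) :
    ∀ {u v : V} (_ : (openGraph ω).Walk u v), (openGraph ω).Reachable x u →
      (SimpleGraph.fromEdgeSet (openEdgeCluster ω x)).Reachable x u →
      (SimpleGraph.fromEdgeSet (openEdgeCluster ω x)).Reachable x v := by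
  intro u v p
  induction p with
  | nil => intro _ h; exact h
  | cons hadj q ih =>
    rename_i a c _
    intro hxa hxa'
    have hac := (openGraph_adj ω a c).1 hadj
    have hxc : (openGraph ω).Reachable x c := hxa.trans ⟨SimpleGraph.Walk.cons hadj SimpleGraph.Walk.nil⟩
    have he : s(a, c) ∈ openEdgeCluster ω x := by
      refine (mem_openEdgeCluster_iff ω x _).2 ⟨hac.1, ?_, fun v hv => ?_⟩
      · rw [Sym2.mk_isDiag_iff]; exact hac.2
      · rcases Sym2.mem_iff.1 hv with rfl | rfl
        · exact hxa
        · exact hxc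
    have hadj' : (SimpleGraph.fromEdgeSet (openEdgeCluster ω x)).Adj a c :=
      (SimpleGraph.fromEdgeSet_adj _).2 ⟨he, hac.2⟩
    exact ih hxc (hxa'.trans ⟨SimpleGraph.Walk.cons hadj' SimpleGraph.Walk.nil⟩)

/-- **Reachability from `x ∈ S` inside `C_S = ⋃_{s∈S} C_s` is reachability in the configuration.** [folklore] -/
theorem reachIn_biUnion_iff (ω : BondConfig V) (S : Set V) (x v : V) (hx : x ∈ S) :
    (SimpleGraph.fromEdgeSet (⋃ s ∈ S, openEdgeCluster ω s)).Reachable x v ↔ (openGraph ω).Reachable x v := by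
  constructor
  · intro h
    have hsub : (⋃ s ∈ S, openEdgeCluster ω s) ⊆ ω := by
      intro e he
      simp only [mem_iUnion, exists_prop] at he
      obtain ⟨s, _, hes⟩ := he
      exact openEdgeCluster_subset ω s hes
    exact h.mono (SimpleGraph.fromEdgeSet_mono hsub)
  · intro h
    obtain ⟨p⟩ := h
    have h1 : (SimpleGraph.fromEdgeSet (openEdgeCluster ω x)).Reachable x v :=
      reachIn_cluster_of_walk ω x p (SimpleGraph.Reachable.refl x) (SimpleGraph.Reachable.refl x)
    exact reachIn_mono x v (subset_biUnion_of_mem (u := fun s => openEdgeCluster ω s) hx) h1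

/-- **Path exchange, set form.**  With `S = {x, o}`, `T = {y}`, `D' = {S ↮ T} = {x↮y} ∩ {o↮y}`:
`μ(D' ∩ {x↔o} ∩ {y↔b}) · μ(D' ∩ {S↔b}) ≤ μ(D' ∩ {x↔o} ∩ {S↔b}) · μ(D' ∩ {y↔b})`,
an instance of `setClusterEventExchange` (BHK 2006 two-set conditional association) with
`A₁ = {x↔o}` (reachability inside `C_S`), `A₂ = {S↔b}`, `B₁ = {y↔b}`, `B₂ = ⊤`.
[cite: VandenbergHaggstromKahn2005, Thm. 2.1 (p. 9) at q = 1 with Remark 1 (p. 5) — corollary via `setClusterEventExchange`, derived in this file] -/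
theorem pathExchange_set [Fintype V] (w : Sym2 V → unitInterval) (o x y b : V) :
    (prodBernoulli w).real (({ω : BondConfig V | ∀ s ∈ ({x, o} : Set V), ∀ t ∈ ({y} : Set V),
        ¬ (openGraph ω).Reachable s t}) ∩ (openConn x o ∩ openConn y b)) *
      (prodBernoulli w).real (({ω : BondConfig V | ∀ s ∈ ({x, o} : Set V), ∀ t ∈ ({y} : Set V),
        ¬ (openGraph ω).Reachable s t}) ∩ ⋃ s ∈ ({x, o} : Set V), openConn s b) ≤
    (prodBernoulli w).real (({ω : BondConfig V | ∀ s ∈ ({x, o} : Set V), ∀ t ∈ ({y} : Set V),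
        ¬ (openGraph ω).Reachable s t}) ∩ (openConn x o ∩ ⋃ s ∈ ({x, o} : Set V), openConn s b)) *
      (prodBernoulli w).real (({ω : BondConfig V | ∀ s ∈ ({x, o} : Set V), ∀ t ∈ ({y} : Set V),
        ¬ (openGraph ω).Reachable s t}) ∩ openConn y b) := by
  set S : Set V := {x, o} with hS
  set T : Set V := {y} with hT
  have hxS : x ∈ S := by rw [hS]; exact mem_insert x {o}
  have key := setClusterEventExchange w S T
    (fun C => (SimpleGraph.fromEdgeSet C).Reachable x o) (fun C => b ∈ S ∨ ∃ e ∈ C, b ∈ e)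
    (fun C => b ∈ T ∨ ∃ e ∈ C, b ∈ e) (fun _ => True)
    (fun C C' h hr => reachIn_mono x o h hr)
    (fun C C' h => Or.imp_right fun ⟨e, he, hbe⟩ => ⟨e, h he, hbe⟩)
    (fun C C' h => Or.imp_right fun ⟨e, he, hbe⟩ => ⟨e, h he, hbe⟩)
    (fun _ _ _ _ => trivial)
  have e1 : {ω : BondConfig V | (SimpleGraph.fromEdgeSet (⋃ s ∈ S, openEdgeCluster ω s)).Reachable x o} =
      openConn x o := by
    ext ω; exact reachIn_biUnion_iff ω S x o hxS
  have e2 : {ω : BondConfig V | b ∈ T ∨ ∃ e ∈ ⋃ t ∈ T, openEdgeCluster ω t, b ∈ e} = openConn y b := by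
    rw [TwoSetConditionalAssociation.setOf_mem_or_exists_mem_biUnion_openEdgeCluster T b, hT]
    simp only [mem_singleton_iff, iUnion_iUnion_eq_left]
  have e3 : {ω : BondConfig V | True} = univ := by ext; simp
  simp only [TwoSetConditionalAssociation.setOf_mem_or_exists_mem_biUnion_openEdgeCluster S b, e1, e2, e3,
    inter_univ] at key
  exact key

/-- Reachability helpers. [folklore] -/
theorem rs {ω : BondConfig V} {u v : V} (h : (openGraph ω).Reachable u v) : (openGraph ω).Reachable v u := h.symm

end PathExchange

open PathExchange

variable {V : Type*}

/-- **Path exchange (four-point form, PROVED).**  For vertices `o, x, y, b`: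
`μ({o↔x}∩{y↔b}∩{x↮y}) · μ({x↔b}∩{o↮x}∩{o↮y}∩{x↮y}) ≤ μ({o↔x}∩{x↔b}∩{x↮y}) · μ({y↔b}∩{o↮x}∩{o↮y}∩{x↮y})`,
i.e. `P(ox|yb) · P(o|xb|y) ≤ P(oxb|y) · P(o|x|yb)` on the partition lattice of `{o, x, y, b}`.
From `pathExchange_set`: `μ(D'∩{y↔b}) = P(ox|yb) + P(o|x|yb)` and `μ(D'∩{S↔b}) ≥ P(oxb|y) + P(o|xb|y)`.
[cite: VandenbergHaggstromKahn2005, Thm. 2.1 (p. 9) at q = 1 — corollary, derived in this file] -/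
theorem pathExchange [Fintype V] (w : Sym2 V → unitInterval) (o x y b : V) :
    (prodBernoulli w).real (openConn o x ∩ openConn y b ∩ (openConn x y)ᶜ) *
        (prodBernoulli w).real (openConn x b ∩ (openConn o x)ᶜ ∩ (openConn o y)ᶜ ∩ (openConn x y)ᶜ) ≤
      (prodBernoulli w).real (openConn o x ∩ openConn x b ∩ (openConn x y)ᶜ) *
        (prodBernoulli w).real (openConn y b ∩ (openConn o x)ᶜ ∩ (openConn o y)ᶜ ∩ (openConn x y)ᶜ) := by
  set μ := prodBernoulli w with hμ
  have key := pathExchange_set w o x y b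
  set D' : Set (BondConfig V) := {ω : BondConfig V | ∀ s ∈ ({x, o} : Set V), ∀ t ∈ ({y} : Set V),
        ¬ (openGraph ω).Reachable s t} with hD'
  have hD : ∀ ω : BondConfig V, ω ∈ D' ↔ (¬ (openGraph ω).Reachable x y ∧ ¬ (openGraph ω).Reachable o y) := by
    intro ω
    simp only [hD', mem_setOf_eq, mem_insert_iff, mem_singleton_iff, forall_eq_or_imp, forall_eq]
  -- the four events
  set Vv := μ.real (openConn o x ∩ openConn y b ∩ (openConn x y)ᶜ) with hVv
  set Rr := μ.real (openConn o x ∩ openConn x b ∩ (openConn x y)ᶜ) with hRr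
  set Mx := μ.real (openConn x b ∩ (openConn o x)ᶜ ∩ (openConn o y)ᶜ ∩ (openConn x y)ᶜ) with hMx
  set My := μ.real (openConn y b ∩ (openConn o x)ᶜ ∩ (openConn o y)ᶜ ∩ (openConn x y)ᶜ) with hMy
  -- (i) D' ∩ ({x↔o} ∩ {y↔b}) = V-event
  have e1 : D' ∩ (openConn x o ∩ openConn y b) = (openConn o x ∩ openConn y b ∩ (openConn x y)ᶜ : Set (BondConfig V)) := by
    ext ω
    simp only [mem_inter_iff, mem_compl_iff, hD ω, openConn, mem_setOf_eq]
    constructor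
    · rintro ⟨⟨hxy, _⟩, hxo, hyb⟩; exact ⟨⟨rs hxo, hyb⟩, hxy⟩
    · rintro ⟨⟨hox, hyb⟩, hxy⟩
      exact ⟨⟨hxy, fun hoy => hxy ((rs hox).trans hoy)⟩, rs hox, hyb⟩
  -- (ii) D' ∩ ({x↔o} ∩ {S↔b}) = R-event
  have e2 : D' ∩ (openConn x o ∩ ⋃ s ∈ ({x, o} : Set V), openConn s b) =
      (openConn o x ∩ openConn x b ∩ (openConn x y)ᶜ : Set (BondConfig V)) := by
    ext ω
    simp only [mem_inter_iff, mem_compl_iff, hD ω, openConn, mem_setOf_eq, mem_iUnion, exists_prop,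
      mem_insert_iff, mem_singleton_iff]
    constructor
    · rintro ⟨⟨hxy, _⟩, hxo, s, hs, hsb⟩
      rcases hs with rfl | rfl
      · exact ⟨⟨rs hxo, hsb⟩, hxy⟩
      · exact ⟨⟨rs hxo, hxo.trans hsb⟩, hxy⟩
    · rintro ⟨⟨hox, hxb⟩, hxy⟩
      exact ⟨⟨hxy, fun hoy => hxy ((rs hox).trans hoy)⟩, rs hox, x, Or.inl rfl, hxb⟩
  -- (iii) μ(D' ∩ {y↔b}) = V + m°_y
  have e3 : μ.real (D' ∩ openConn y b) = Vv + My := by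
    have hsplit : D' ∩ openConn y b = (openConn o x ∩ openConn y b ∩ (openConn x y)ᶜ) ∪
        (openConn y b ∩ (openConn o x)ᶜ ∩ (openConn o y)ᶜ ∩ (openConn x y)ᶜ) := by
      ext ω
      simp only [mem_inter_iff, mem_compl_iff, hD ω, openConn, mem_setOf_eq, mem_union]
      constructor
      · rintro ⟨⟨hxy, hoy⟩, hyb⟩
        by_cases hox : (openGraph ω).Reachable o x
        · exact Or.inl ⟨⟨hox, hyb⟩, hxy⟩
        · exact Or.inr ⟨⟨⟨hyb, hox⟩, hoy⟩, hxy⟩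
      · rintro (⟨⟨hox, hyb⟩, hxy⟩ | ⟨⟨⟨hyb, hox⟩, hoy⟩, hxy⟩)
        · exact ⟨⟨hxy, fun hoy => hxy ((rs hox).trans hoy)⟩, hyb⟩
        · exact ⟨⟨hxy, hoy⟩, hyb⟩
    rw [hsplit, measureReal_union ?_ MeasurableSet.of_discrete]
    exact Set.disjoint_left.2 fun ω h1 h2 => h2.1.1.2 h1.1.1
  -- (iv) μ(D' ∩ {S↔b}) ≥ R + m°_x
  have e4 : Rr + Mx ≤ μ.real (D' ∩ ⋃ s ∈ ({x, o} : Set V), openConn s b) := by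
    have hsub : (openConn o x ∩ openConn x b ∩ (openConn x y)ᶜ) ∪
        (openConn x b ∩ (openConn o x)ᶜ ∩ (openConn o y)ᶜ ∩ (openConn x y)ᶜ) ⊆
        D' ∩ ⋃ s ∈ ({x, o} : Set V), openConn s b := by
      intro ω hω
      simp only [mem_inter_iff, mem_compl_iff, hD ω, openConn, mem_setOf_eq, mem_union, mem_iUnion, exists_prop,
        mem_insert_iff, mem_singleton_iff] at hω ⊢
      rcases hω with ⟨⟨hox, hxb⟩, hxy⟩ | ⟨⟨⟨hxb, hox⟩, hoy⟩, hxy⟩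
      · exact ⟨⟨hxy, fun hoy => hxy ((rs hox).trans hoy)⟩, x, Or.inl rfl, hxb⟩
      · exact ⟨⟨hxy, hoy⟩, x, Or.inl rfl, hxb⟩
    have hdisj : Disjoint (openConn o x ∩ openConn x b ∩ (openConn x y)ᶜ : Set (BondConfig V))
        (openConn x b ∩ (openConn o x)ᶜ ∩ (openConn o y)ᶜ ∩ (openConn x y)ᶜ) :=
      Set.disjoint_left.2 fun ω h1 h2 => h2.1.1.2 h1.1.1
    calc Rr + Mx = μ.real ((openConn o x ∩ openConn x b ∩ (openConn x y)ᶜ) ∪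
        (openConn x b ∩ (openConn o x)ᶜ ∩ (openConn o y)ᶜ ∩ (openConn x y)ᶜ)) := by
          rw [measureReal_union hdisj MeasurableSet.of_discrete]
      _ ≤ _ := measureReal_mono hsub
  rw [e1, e2, e3] at key
  -- key : Vv * μ(D' ∩ ⋃) ≤ Rr * (Vv + My); combine with e4
  have hV0 : 0 ≤ Vv := measureReal_nonneg
  have h1 : Vv * (Rr + Mx) ≤ Vv * μ.real (D' ∩ ⋃ s ∈ ({x, o} : Set V), openConn s b) :=
    mul_le_mul_of_nonneg_left e4 hV0
  nlinarith [h1, key]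

end Summit.CriticalPhenomena.PercolationContinuityZ3.Theorems

end
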